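import Literature.Topology.FourManifolds.TwoKnotNormalSection
import HarnessLib

/-!
# Bicollars of smooth codimension-one spheres in spheres

Topic `Literature/Topology/FourManifolds` (fact seat
`provefact-Literature.Topology.FourManifolds.exists_homeomorph_image_eq_sphereEquator_of_sphereEmbedding`,
the smooth case of the Brown–Mazur generalised Schoenflies theorem, `SliceKnots.lean`).
**Everything in this file is proved.**

Brown's theorem (Brown 1960; Daverman 1986, §II.6, Thm. 6, proved in the tree as
`Literature.Topology.FourManifolds.exists_homeomorph_sphere_image_collar_eq_equator`,
`SchoenfliesSeparation.lean`) is about *bicollared* spheres `h : Sᵐ × [-1, 1] ↪ Sᵐ⁺¹`.  A smoothly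
embedded sphere `f : Sᵐ ↪ Sᵐ⁺¹` is bicollared: its normal bundle is a line bundle which is
trivial because `Sᵐ⁺¹` and `Sᵐ` are orientable (the hypersurface is *two-sided*), and a tubular
neighbourhood of a submanifold with trivialised normal bundle is a product (Hirsch, *Differential
Topology* (1976), Ch. 4, §5, Thms. 5.1–5.2, proved in the tree for normally framed maps into round
spheres: `Literature.Topology.FourManifolds.IsNormalFraming.exists_isSmoothEmbedding_tube_of_isSmoothEmbedding`,
`FramedTubularNbhd.lean`).  This file supplies the two-sidedness in coordinates and packages the
collar:

* §1 the calculus of an immersion `f : 𝕊 m → 𝕊 (m+1)` read in `ℝᵐ⁺²` through the radial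
  extension `K̃ = ι ∘ f ∘ (y ↦ y/‖y‖)` (`Literature.Topology.FourManifolds.sphExt`,
  `TwoKnotNormalSection.lean`) and its derivative `L = DK̃(x)` (`SphereHypersurface.dExt`):
  `L x = 0`, `L|_{xᗮ} = df`, `df` injective with values in `(f x)ᗮ` — the general-dimension
  versions of the `S² → S⁴` lemmas of `TwoKnotNormalSection.lean`;
* §2 **the normal field**: with the row map `A = L + ⟪x, ·⟫ f x : ℝᵐ⁺¹ → ℝᵐ⁺²`
  (`SphereHypersurface.rowMap`; `A x = f x`, `A|_{xᗮ} = L|_{xᗮ}`, so `A` is injective with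
  image `ℝ f x ⊕ df(T_x 𝕊 m)`), the **normal field** is the `(m+1)`-fold cross product
  `ν(x) = vecCross (A e₀, …, A e_m)` (`SphereHypersurface.normalField`,
  `Literature.Topology.FourManifolds.vecCross`): smooth, orthogonal to `f x` and to the tangent
  space, and nowhere zero (cross product of independent vectors) — i.e. the positively oriented
  unit normal up to a positive function, written without choosing tangent frames;
  `SphereHypersurface.isNormalFraming_normalField`: it is a normal `1`-framing
  (`Literature.Topology.FourManifolds.IsNormalFraming`);
* §3 **the bicollar** (`exists_collar_of_isSmoothEmbedding`): for a smooth embedding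
  `f : 𝕊 m → 𝕊 (m+1)` there is a continuous injection `h : 𝕊 m × [-1, 1] → 𝕊 (m+1)` with
  `h(x, 0) = f x`, namely `h(x, t) = tube ε (x, t e₀)` for the tube of the normal framing.

## References

* M. W. Hirsch, *Differential Topology*, GTM 33 (1976), Ch. 4, §5, Thms. 5.1–5.2 (tubular
  neighbourhoods), Ch. 4, §4 (the normal bundle of a two-sided hypersurface is trivial).
  [HirschDT1976]
* M. Brown, *A proof of the generalized Schoenflies theorem*, Bull. Amer. Math. Soc. 66 (1960)
  74–76. [Brown1960]

## Design notes

* No orientation theory is used: the row map `A` adjoins the position vector to the tangent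
  directions `L e_j`, and the cross product of the `m + 1` independent rows is the normal.
* Everything is stated for maps between the round spheres of `Knots.lean`
  (`𝕊 k = sphere (0 : EuclideanSpace ℝ (Fin (k+1))) 1`); the ambient space of `𝕊 (m+1)` is
  written `𝔼 (m+1+1)`.
-/

open scoped Manifold ContDiff Topology RealInnerProductSpace
open Set Function Metric Module

noncomputable section

namespace Literature.Topology.FourManifolds

/-- Local notation: `𝔼 n` is the model Euclidean space `EuclideanSpace ℝ (Fin n)`. -/
local notation "𝔼 " n:arg => EuclideanSpace ℝ (Fin n)

/-- Local notation: `𝕊 n` is the unit sphere in `EuclideanSpace ℝ (Fin (n + 1))`. -/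
local notation "𝕊 " n:arg => (Metric.sphere (0 : EuclideanSpace ℝ (Fin (n + 1))) 1)

namespace SphereHypersurface

variable {m : ℕ} {f : 𝕊 m → 𝕊 (m + 1)}

/-! ### §1 The derivative of the radial extension of a map `𝕊 m → 𝕊 (m+1)` -/

/-- The radial extension `K̃` of `ι ∘ f : 𝕊 m → ℝᵐ⁺²` to `ℝᵐ⁺¹`. [folklore] -/
abbrev extF (f : 𝕊 m → 𝕊 (m + 1)) : 𝔼 (m + 1) → 𝔼 (m + 1 + 1) :=
  sphExt fun y => (f y : 𝔼 (m + 1 + 1))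

/-- The derivative `L = DK̃(x) : ℝᵐ⁺¹ →L ℝᵐ⁺²` of the radial extension at a point of the sphere.
[folklore] -/
def dExt (f : 𝕊 m → 𝕊 (m + 1)) (x : 𝕊 m) : 𝔼 (m + 1) →L[ℝ] 𝔼 (m + 1 + 1) :=
  fderiv ℝ (extF f) (x : 𝔼 (m + 1))

/-- `ι ∘ f` is smooth when `f` is. [folklore] -/
theorem contMDiff_coe_comp (hf : ContMDiff (𝓡 m) (𝓡 (m + 1)) ∞ f) :
    ContMDiff (𝓡 m) 𝓘(ℝ, 𝔼 (m + 1 + 1)) ∞ fun y => (f y : 𝔼 (m + 1 + 1)) :=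
  haveI := Fact.mk (@finrank_euclideanSpace_fin ℝ _ (m + 1 + 1))
  contMDiff_coe_sphere.comp hf

/-- `L x = 0` (the extension is radially constant). [folklore] -/
theorem dExt_apply_self (hf : ContMDiff (𝓡 m) (𝓡 (m + 1)) ∞ f) (x : 𝕊 m) :
    dExt f x (x : 𝔼 (m + 1)) = 0 :=
  fderiv_sphExt_apply_self (contMDiff_coe_comp hf) (ne_zero_of_mem_unit_sphere x)

/-- The ambient differential of `f` factors as `L ∘ dι`. [folklore] -/
theorem ambientDeriv_eq_comp (hf : ContMDiff (𝓡 m) (𝓡 (m + 1)) ∞ f) (x : 𝕊 m) :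
    ambientDeriv (𝓡 m) f x =
      (dExt f x).comp (mfderiv (𝓡 m) 𝓘(ℝ, 𝔼 (m + 1)) (Subtype.val : 𝕊 m → 𝔼 (m + 1)) x) :=
  mfderiv_eq_fderiv_sphExt_comp (contMDiff_coe_comp hf) x

/-- Pointwise form of `ambientDeriv_eq_comp`. [folklore] -/
theorem ambientDeriv_apply_eq (hf : ContMDiff (𝓡 m) (𝓡 (m + 1)) ∞ f) (x : 𝕊 m)
    (v : EuclideanSpace ℝ (Fin m)) :
    ambientDeriv (𝓡 m) f x v =
      dExt f x (mfderiv (𝓡 m) 𝓘(ℝ, 𝔼 (m + 1)) (Subtype.val : 𝕊 m → 𝔼 (m + 1)) x v) := by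
  rw [ambientDeriv_eq_comp hf]; rfl

/-- Vectors orthogonal to `x` are tangent vectors of `𝕊 m` at `x` read in `ℝᵐ⁺¹`
(`range_mfderiv_coe_sphere`). [folklore] -/
theorem exists_mfderiv_coe_eq (x : 𝕊 m) {p : 𝔼 (m + 1)} (hp : ⟪p, (x : 𝔼 (m + 1))⟫ = 0) :
    ∃ v : EuclideanSpace ℝ (Fin m),
      mfderiv (𝓡 m) 𝓘(ℝ, 𝔼 (m + 1)) (Subtype.val : 𝕊 m → 𝔼 (m + 1)) x v = p := by
  haveI := Fact.mk (@finrank_euclideanSpace_fin ℝ _ (m + 1))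
  have hmem : p ∈ (ℝ ∙ (x : 𝔼 (m + 1)))ᗮ :=
    Submodule.mem_orthogonal_singleton_iff_inner_left.2 hp
  rw [← range_mfderiv_coe_sphere (n := m) x] at hmem
  exact hmem

/-- Tangent vectors of `𝕊 m` at `x`, read in `ℝᵐ⁺¹`, are orthogonal to `x`. [folklore] -/
theorem inner_self_mfderiv_coe (x : 𝕊 m) (v : EuclideanSpace ℝ (Fin m)) :
    ⟪(x : 𝔼 (m + 1)),
      mfderiv (𝓡 m) 𝓘(ℝ, 𝔼 (m + 1)) (Subtype.val : 𝕊 m → 𝔼 (m + 1)) x v⟫ = 0 := by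
  haveI := Fact.mk (@finrank_euclideanSpace_fin ℝ _ (m + 1))
  have hmem : mfderiv (𝓡 m) 𝓘(ℝ, 𝔼 (m + 1)) (Subtype.val : 𝕊 m → 𝔼 (m + 1)) x v ∈
      (ℝ ∙ (x : 𝔼 (m + 1)))ᗮ := by
    rw [← range_mfderiv_coe_sphere (n := m) x]
    exact ⟨v, rfl⟩
  exact Submodule.mem_orthogonal_singleton_iff_inner_right.1 hmem

/-- The ambient differential of an immersion into `𝕊 (m+1)` is injective. [folklore] -/
theorem injective_ambientDeriv (hf : ContMDiff (𝓡 m) (𝓡 (m + 1)) ∞ f)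
    (hf' : ∀ x, Injective (mfderiv (𝓡 m) (𝓡 (m + 1)) f x)) (x : 𝕊 m) :
    Injective (ambientDeriv (𝓡 m) f x) := by
  haveI := Fact.mk (@finrank_euclideanSpace_fin ℝ _ (m + 1 + 1))
  have hval : MDifferentiableAt (𝓡 (m + 1)) 𝓘(ℝ, 𝔼 (m + 1 + 1))
      (Subtype.val : 𝕊 (m + 1) → 𝔼 (m + 1 + 1)) (f x) :=
    (contMDiff_coe_sphere (m := 1)).contMDiffAt.mdifferentiableAt one_ne_zero
  have hfd : MDifferentiableAt (𝓡 m) (𝓡 (m + 1)) f x := (hf x).mdifferentiableAt (by simp)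
  have hcomp : ambientDeriv (𝓡 m) f x =
      (mfderiv (𝓡 (m + 1)) 𝓘(ℝ, 𝔼 (m + 1 + 1)) (Subtype.val : 𝕊 (m + 1) → 𝔼 (m + 1 + 1))
        (f x)).comp (mfderiv (𝓡 m) (𝓡 (m + 1)) f x) :=
    mfderiv_comp x hval hfd
  have key : ∀ v, ambientDeriv (𝓡 m) f x v =
      mfderiv (𝓡 (m + 1)) 𝓘(ℝ, 𝔼 (m + 1 + 1)) (Subtype.val : 𝕊 (m + 1) → 𝔼 (m + 1 + 1))
        (f x) (mfderiv (𝓡 m) (𝓡 (m + 1)) f x v) :=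
    fun v => by rw [hcomp]; rfl
  intro v w hvw
  rw [key, key] at hvw
  exact hf' x (mfderiv_coe_sphere_injective (n := m + 1) (f x) hvw)

/-- The ambient differential of `f` takes values in the tangent space `(f x)ᗮ` of `𝕊 (m+1)`.
[folklore] -/
theorem inner_ambientDeriv_eq_zero (hf : ContMDiff (𝓡 m) (𝓡 (m + 1)) ∞ f) (x : 𝕊 m)
    (v : EuclideanSpace ℝ (Fin m)) :
    ⟪ambientDeriv (𝓡 m) f x v, (f x : 𝔼 (m + 1 + 1))⟫ = 0 := by
  haveI := Fact.mk (@finrank_euclideanSpace_fin ℝ _ (m + 1 + 1))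
  have hval : MDifferentiableAt (𝓡 (m + 1)) 𝓘(ℝ, 𝔼 (m + 1 + 1))
      (Subtype.val : 𝕊 (m + 1) → 𝔼 (m + 1 + 1)) (f x) :=
    (contMDiff_coe_sphere (m := 1)).contMDiffAt.mdifferentiableAt one_ne_zero
  have hfd : MDifferentiableAt (𝓡 m) (𝓡 (m + 1)) f x := (hf x).mdifferentiableAt (by simp)
  have hcomp : ambientDeriv (𝓡 m) f x =
      (mfderiv (𝓡 (m + 1)) 𝓘(ℝ, 𝔼 (m + 1 + 1)) (Subtype.val : 𝕊 (m + 1) → 𝔼 (m + 1 + 1))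
        (f x)).comp (mfderiv (𝓡 m) (𝓡 (m + 1)) f x) :=
    mfderiv_comp x hval hfd
  have hmem : ambientDeriv (𝓡 m) f x v ∈ (ℝ ∙ (f x : 𝔼 (m + 1 + 1)))ᗮ := by
    rw [← range_mfderiv_coe_sphere (n := m + 1) (f x), hcomp]
    exact ⟨_, rfl⟩
  exact Submodule.mem_orthogonal_singleton_iff_inner_left.1 hmem

/-- Every value `L p` with `p ⊥ x` is a value of the ambient differential. [folklore] -/
theorem exists_ambientDeriv_eq (hf : ContMDiff (𝓡 m) (𝓡 (m + 1)) ∞ f) (x : 𝕊 m)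
    {p : 𝔼 (m + 1)} (hp : ⟪p, (x : 𝔼 (m + 1))⟫ = 0) :
    ∃ v : EuclideanSpace ℝ (Fin m), ambientDeriv (𝓡 m) f x v = dExt f x p := by
  obtain ⟨v, hv⟩ := exists_mfderiv_coe_eq x hp
  exact ⟨v, by rw [ambientDeriv_apply_eq hf, hv]⟩

/-! ### §2 The normal field of an immersion `𝕊 m → 𝕊 (m+1)` -/

/-- The **row map** `A = L + ⟪x, ·⟫ f x : ℝᵐ⁺¹ →L ℝᵐ⁺²` of `f` at `x`: it sends `x` to the position
vector `f x` and agrees with `L = DK̃(x)` on `xᗮ = T_x 𝕊 m`, so that (for an immersion) it is a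
linear injection onto `ℝ f x ⊕ df(T_x 𝕊 m) = (normal line)ᗮ`. [folklore] -/
def rowMap (f : 𝕊 m → 𝕊 (m + 1)) (x : 𝕊 m) : 𝔼 (m + 1) →L[ℝ] 𝔼 (m + 1 + 1) :=
  dExt f x + (innerSL ℝ (x : 𝔼 (m + 1))).smulRight (f x : 𝔼 (m + 1 + 1))

/-- `A p = L p + ⟪x, p⟫ f x`. [folklore] -/
theorem rowMap_apply (x : 𝕊 m) (p : 𝔼 (m + 1)) :
    rowMap f x p = dExt f x p + ⟪(x : 𝔼 (m + 1)), p⟫ • (f x : 𝔼 (m + 1 + 1)) := by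
  simp [rowMap]

/-- `A x = f x`. [folklore] -/
theorem rowMap_apply_self (hf : ContMDiff (𝓡 m) (𝓡 (m + 1)) ∞ f) (x : 𝕊 m) :
    rowMap f x (x : 𝔼 (m + 1)) = (f x : 𝔼 (m + 1 + 1)) := by
  rw [rowMap_apply, dExt_apply_self hf, real_inner_self_eq_norm_sq, norm_eq_of_mem_sphere x]
  simp

/-- `A p = L p` for `p ⊥ x`. [folklore] -/
theorem rowMap_apply_of_inner_eq_zero (x : 𝕊 m) {p : 𝔼 (m + 1)}
    (hp : ⟪p, (x : 𝔼 (m + 1))⟫ = 0) : rowMap f x p = dExt f x p := by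
  rw [rowMap_apply, real_inner_comm, hp, zero_smul, add_zero]

/-- **The row map of an immersion is injective.** If `A p = 0`, split `p = p' + ⟪p, x⟫ x` with
`p' ⊥ x`; then `A p = L p' + ⟪p, x⟫ f x` with `L p' = df(w) ⊥ f x`, so pairing with `f x` kills
`⟪p, x⟫`, and then `df(w) = 0` forces `w = 0`, `p' = 0`. [folklore] -/
theorem injective_rowMap (hf : ContMDiff (𝓡 m) (𝓡 (m + 1)) ∞ f)
    (hf' : ∀ x, Injective (mfderiv (𝓡 m) (𝓡 (m + 1)) f x)) (x : 𝕊 m) :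
    Injective (rowMap f x) := by
  refine (injective_iff_map_eq_zero _).2 fun p hp0 => ?_
  set c : ℝ := ⟪p, (x : 𝔼 (m + 1))⟫ with hc
  set p' : 𝔼 (m + 1) := p - c • (x : 𝔼 (m + 1)) with hp'
  have hx1 : ‖(x : 𝔼 (m + 1))‖ = 1 := norm_eq_of_mem_sphere x
  have hperp : ⟪p', (x : 𝔼 (m + 1))⟫ = 0 := by
    rw [hp', inner_sub_left, inner_smul_left, real_inner_self_eq_norm_sq, hx1]
    simp [hc]
  have hsplit : p = p' + c • (x : 𝔼 (m + 1)) := by rw [hp']; abel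
  obtain ⟨w, hw⟩ := exists_mfderiv_coe_eq x hperp
  have hLp' : dExt f x p' = ambientDeriv (𝓡 m) f x w := by rw [ambientDeriv_apply_eq hf, hw]
  -- `A p = df(w) + c • f x`
  have hAp : rowMap f x p = ambientDeriv (𝓡 m) f x w + c • (f x : 𝔼 (m + 1 + 1)) := by
    rw [hsplit, map_add, map_smul, rowMap_apply_self hf, rowMap_apply_of_inner_eq_zero x hperp,
      hLp']
  rw [hAp] at hp0
  -- pairing with `f x`: `c = 0`
  have hc0 : c = 0 := by
    have h := congrArg (fun z => ⟪z, (f x : 𝔼 (m + 1 + 1))⟫) hp0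
    simpa [inner_add_left, inner_smul_left, inner_ambientDeriv_eq_zero hf x w,
      real_inner_self_eq_norm_sq, norm_eq_of_mem_sphere (f x)] using h
  rw [hc0, zero_smul, add_zero] at hp0
  have hw0 : w = 0 := (injective_iff_map_eq_zero _).1 (injective_ambientDeriv hf hf' x) _ hp0
  have hp'0 : p' = 0 := by
    rw [← hw, hw0]
    exact (mfderiv (𝓡 m) 𝓘(ℝ, 𝔼 (m + 1)) (Subtype.val : 𝕊 m → 𝔼 (m + 1)) x).map_zero
  rw [hsplit, hp'0, hc0, zero_smul, add_zero]

/-- The **rows** `A e₀, …, A e_m` of `f` at `x`: `A e_j = L e_j + x_j • f x`. [folklore] -/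
def normalRows (f : 𝕊 m → 𝕊 (m + 1)) (x : 𝕊 m) (j : Fin (m + 1)) : 𝔼 (m + 1 + 1) :=
  dExt f x (EuclideanSpace.single j 1) + (x : 𝔼 (m + 1)) j • (f x : 𝔼 (m + 1 + 1))

/-- `A e_j` is the `j`-th row. [folklore] -/
theorem rowMap_single (x : 𝕊 m) (j : Fin (m + 1)) :
    rowMap f x (EuclideanSpace.single j 1) = normalRows f x j := by
  rw [rowMap_apply, EuclideanSpace.inner_single_right, normalRows]
  simp

/-- The rows are the images of the standard basis under the row map. [folklore] -/
theorem normalRows_eq_comp (x : 𝕊 m) :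
    normalRows f x = ⇑(rowMap f x).toLinearMap ∘ ⇑(EuclideanSpace.basisFun (Fin (m + 1)) ℝ) := by
  funext j
  simp [EuclideanSpace.basisFun_apply, ← rowMap_single]

/-- **The rows of an immersion are linearly independent.** [folklore] -/
theorem linearIndependent_normalRows (hf : ContMDiff (𝓡 m) (𝓡 (m + 1)) ∞ f)
    (hf' : ∀ x, Injective (mfderiv (𝓡 m) (𝓡 (m + 1)) f x)) (x : 𝕊 m) :
    LinearIndependent ℝ (normalRows f x) := by
  rw [normalRows_eq_comp, ← OrthonormalBasis.coe_toBasis]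
  exact (EuclideanSpace.basisFun (Fin (m + 1)) ℝ).toBasis.linearIndependent.map' _
    (LinearMap.ker_eq_bot.2 (injective_rowMap hf hf' x))

/-- `A p = ∑ⱼ pⱼ • (A e_j)`. [folklore] -/
theorem rowMap_eq_sum (x : 𝕊 m) (p : 𝔼 (m + 1)) :
    rowMap f x p = ∑ j, p j • normalRows f x j := by
  conv_lhs => rw [← (EuclideanSpace.basisFun (Fin (m + 1)) ℝ).sum_repr p]
  simp [map_sum, map_smul, EuclideanSpace.basisFun_apply, EuclideanSpace.basisFun_repr,
    rowMap_single]

/-- The **normal field** of `f : 𝕊 m → 𝕊 (m+1)`: the cross product of the rows,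
`ν(x) = vecCross (A e₀, …, A e_m) ∈ ℝᵐ⁺²` — a vector orthogonal to `f x` and to `df(T_x 𝕊 m)`,
nonzero when `f` is an immersion (a positive multiple of the oriented unit normal).
[cite: HirschDT1976, Ch. 4 §4 (two-sided hypersurfaces have trivial normal bundle)] -/
def normalField (f : 𝕊 m → 𝕊 (m + 1)) (x : 𝕊 m) : 𝔼 (m + 1 + 1) :=
  vecCross (normalRows f x)

/-- The normal field is orthogonal to every value of the row map. [folklore] -/
theorem inner_normalField_rowMap (x : 𝕊 m) (p : 𝔼 (m + 1)) :
    ⟪normalField f x, rowMap f x p⟫ = 0 := by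
  rw [rowMap_eq_sum, inner_sum]
  refine Finset.sum_eq_zero fun j _ => ?_
  rw [inner_smul_right, normalField, inner_vecCross_self, mul_zero]

/-- **The normal field is tangent to `𝕊 (m+1)` along `f`**: `⟪ν x, f x⟫ = 0`. [folklore] -/
theorem inner_normalField_coe (hf : ContMDiff (𝓡 m) (𝓡 (m + 1)) ∞ f) (x : 𝕊 m) :
    ⟪normalField f x, (f x : 𝔼 (m + 1 + 1))⟫ = 0 := by
  rw [← rowMap_apply_self hf x]
  exact inner_normalField_rowMap x _

/-- **The normal field is orthogonal to the tangent space of `f`.** [folklore] -/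
theorem inner_normalField_ambientDeriv (hf : ContMDiff (𝓡 m) (𝓡 (m + 1)) ∞ f) (x : 𝕊 m)
    (v : EuclideanSpace ℝ (Fin m)) : ⟪normalField f x, ambientDeriv (𝓡 m) f x v⟫ = 0 := by
  have hperp := inner_self_mfderiv_coe x v
  rw [real_inner_comm] at hperp
  rw [ambientDeriv_apply_eq hf, ← rowMap_apply_of_inner_eq_zero x hperp]
  exact inner_normalField_rowMap x _

/-- **The normal field of an immersion is nowhere zero.** [folklore] -/
theorem normalField_ne_zero (hf : ContMDiff (𝓡 m) (𝓡 (m + 1)) ∞ f)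
    (hf' : ∀ x, Injective (mfderiv (𝓡 m) (𝓡 (m + 1)) f x)) (x : 𝕊 m) :
    normalField f x ≠ 0 :=
  vecCross_ne_zero_of_linearIndependent (linearIndependent_normalRows hf hf' x)

/-- **The normal field is smooth** (a polynomial in `x`, `f x` and `DK̃(x)`). [folklore] -/
theorem contMDiff_normalField (hf : ContMDiff (𝓡 m) (𝓡 (m + 1)) ∞ f) :
    ContMDiff (𝓡 m) 𝓘(ℝ, 𝔼 (m + 1 + 1)) ∞ (normalField f) := by
  haveI := Fact.mk (@finrank_euclideanSpace_fin ℝ _ (m + 1))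
  have hfE := contMDiff_coe_comp hf
  have hD : ∀ p : 𝔼 (m + 1), ContMDiff (𝓡 m) 𝓘(ℝ, 𝔼 (m + 1 + 1)) ∞ fun x : 𝕊 m => dExt f x p :=
    fun p => (ContinuousLinearMap.apply ℝ (𝔼 (m + 1 + 1)) p).contDiff.comp_contMDiff
      (contMDiff_fderiv_sphExt hfE)
  have hx : ∀ j, ContMDiff (𝓡 m) 𝓘(ℝ, ℝ) ∞ fun x : 𝕊 m => (x : 𝔼 (m + 1)) j := fun j =>
    (EuclideanSpace.proj j).contDiff.comp_contMDiff contMDiff_coe_sphere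
  refine contDiff_vecCross.comp_contMDiff (contMDiff_pi_space.2 fun j => ?_)
  exact (hD _).add ((hx j).smul hfE)

/-- **A smooth immersion `𝕊 m → 𝕊 (m+1)` is normally framed by its normal field** (the normal line
bundle of a codimension-one sphere in a sphere is trivial). [cite: HirschDT1976, Ch. 4 §4] -/
theorem isNormalFraming_normalField (hf : ContMDiff (𝓡 m) (𝓡 (m + 1)) ∞ f)
    (hf' : ∀ x, Injective (mfderiv (𝓡 m) (𝓡 (m + 1)) f x)) :
    IsNormalFraming (𝓡 m) f (fun _ : Fin 1 => normalField f) where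
  contMDiff _ := contMDiff_normalField hf
  inner_eq_zero _ x := inner_normalField_coe hf x
  eq_zero_of_eq x v a h := by
    have h1 : ambientDeriv (𝓡 m) f x v + a 0 • normalField f x = 0 := by
      simpa using h
    have h2 := congrArg (fun z => ⟪normalField f x, z⟫) h1
    simp only [inner_add_right, inner_smul_right, inner_normalField_ambientDeriv hf x v,
      zero_add, inner_zero_right, real_inner_self_eq_norm_sq, mul_eq_zero] at h2
    have ha0 : a 0 = 0 := by
      rcases h2 with h2 | h2
      · exact h2
      · exact absurd (by simpa using h2) (normalField_ne_zero hf hf' x)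
    funext i
    rw [Subsingleton.elim i 0, ha0]
    rfl

end SphereHypersurface

/-! ### §3 The bicollar of a smoothly embedded codimension-one sphere -/

open SphereHypersurface in
/-- **A smoothly embedded `m`-sphere in `𝕊 (m+1)` is bicollared**: for a `C^∞` embedding
`f : 𝕊 m → 𝕊 (m+1)` there is a continuous injection `h : 𝕊 m × [-1, 1] → 𝕊 (m+1)` with
`h (x, 0) = f x` — the tube `(x, t) ↦ tube ε (x, t e₀)` of the normal framing by the normal field
(Hirsch (1976), Ch. 4, §5, Thms. 5.1–5.2 for the trivialised normal bundle, via
`IsNormalFraming.exists_isSmoothEmbedding_tube_of_isSmoothEmbedding`).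
[cite: HirschDT1976, Ch. 4 §5 Thms. 5.1–5.2] -/
theorem exists_collar_of_isSmoothEmbedding {m : ℕ} {f : 𝕊 m → 𝕊 (m + 1)}
    (hf : Manifold.IsSmoothEmbedding (𝓡 m) (𝓡 (m + 1)) ∞ f) :
    ∃ h : 𝕊 m × Icc (-1 : ℝ) 1 → 𝕊 (m + 1), Continuous h ∧ Injective h ∧
      (∀ (x : 𝕊 m) (t : Icc (-1 : ℝ) 1), (t : ℝ) = 0 → h (x, t) = f x) ∧
      h '' {p | (p.2 : ℝ) = 0} = range f := by
  haveI := Fact.mk (@finrank_euclideanSpace_fin ℝ _ (m + 1 + 1))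
  obtain ⟨F, _, _, hF⟩ := hf.isImmersion
  have hfr := isNormalFraming_normalField hf.contMDiff
    (fun x => Manifold.IsImmersionAtOfComplement.mfderiv_injective (hF x) (by simp))
  obtain ⟨ε, -, hemb, -⟩ := hfr.exists_isSmoothEmbedding_tube_of_isSmoothEmbedding (n := m + 1)
    hf (by simp)
  set e₀ : 𝔼 1 := EuclideanSpace.single 0 1 with he₀
  have he₀0 : e₀ ≠ 0 := by
    intro h0
    have := congrArg (fun v : 𝔼 1 => v 0) h0
    simp [he₀] at this
  refine ⟨fun p => hfr.tube ε (p.1, (p.2 : ℝ) • e₀), ?_, ?_, ?_, ?_⟩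
  · exact hemb.contMDiff.continuous.comp
      (continuous_fst.prodMk ((continuous_subtype_val.comp continuous_snd).smul
        continuous_const))
  · rintro ⟨x, t⟩ ⟨y, s⟩ hxy
    have h' := hemb.isEmbedding.injective hxy
    simp only [Prod.mk.injEq] at h'
    obtain ⟨hxy1, hts⟩ := h'
    have hts' : (t : ℝ) = s := smul_left_injective ℝ he₀0 hts
    rw [hxy1, Subtype.ext hts']
  · intro x t ht
    simp only [ht, zero_smul]
    exact hfr.tube_apply_zero ε x
  · ext z
    constructor
    · rintro ⟨⟨x, t⟩, ht, rfl⟩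
      refine ⟨x, ?_⟩
      have ht' : (t : ℝ) = 0 := ht
      simp only [ht', zero_smul]
      exact (hfr.tube_apply_zero ε x).symm
    · rintro ⟨x, rfl⟩
      refine ⟨(x, ⟨0, by norm_num, by norm_num⟩), rfl, ?_⟩
      simp only [zero_smul]
      exact hfr.tube_apply_zero ε x

end Literature.Topology.FourManifolds
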